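import Summits.BirchSwinnertonDyer.BirchSwinnertonDyer.Theorems.UniversalToricDescentKsLinkOfLambdaAdicKS
import HarnessLib

/-!
# The twin at `p = 3`: the registered research stub `stub_ksTwin` of line beta-road (Eisenstein-level Kolyvagin systems with the link)
# from ONE Λ-adic Kolyvagin system for the twin (Howard Thm. 2.3.1 / CGLS Thm. 4.1.1 shape at the multiplicative prime `3`)

Summits-side helper toward crux r205 stmt-BirchSwinnertonDyer-24737 `…Theses.UniversalToricDescent.TwinAlgMuZeroAtThree`, line
`beta-road` (LEAD lineage `bsd-wall-utd-p1`, g27; `--supports`).  ROUTE-INDEPENDENT; ONE THEOREM (no definition, no named fact, no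
instance, no `sorry`); sequel of `UniversalToricDescentKsLinkOfLambdaAdicKS` (the frame-free pushforward + link + non-vanishing).
`twin_ksTwin_of_lambdaAdicKS` proves the registered signature of `stub_ksTwin` (skeleton v14 c0fc4da5a08a26b2) VERBATIM from the Λ-adic
source hypothesis — the body of v15's `stub_ksTwinLambda`: for every choice of the presentation slots `π, cd, πbar, Dsrc`, a Kolyvagin system on
lit's `Λ`-adic source setting `S_Λ` of the twin (`shapiroSettingTame` at the twist `Ψ⁻¹`, `S = {v ∣ 3N′}`, `𝓛 = 𝓛_E`, levels guard) whose
bottom class is `Φ′(𝐳_∞)` (`toShapiroSuccLimitH1`).  No summit statement is proved; BSD is not proved by any of this.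

References: [Howard2004HeegnerKolyvagin] Thm. 2.3.1, Rem. 1.2.4, §1.6, proof of Thm. 2.2.10; [CastellaGrossiLeeSkinner2022] Thm. 4.1.1, Rem. 4.1.4, §3.2, §3.4.
-/

set_option linter.dupNamespace false
set_option autoImplicit false

noncomputable section

open scoped TensorProduct Topology Classical ContRepresentation NumberField
open Field CategoryTheory IsLocalRing IsDedekindDomain

namespace WeierstrassCurve

open Literature.NumberTheory.EllipticCurves Literature.NumberTheory.GaloisRepresentations
open Literature.NumberTheory.GaloisRepresentations.DiscreteGaloisModule
open Literature.NumberTheory.GaloisCohomology.Howard2004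
open Literature.NumberTheory.EllipticCurves.ZpExtension
open Literature.NumberTheory.EllipticCurves.CastellaGrossiLeeSkinner2022
open Summit.BirchSwinnertonDyer.BirchSwinnertonDyer.Theorems

/-! ## §3 The twin at `p = 3`: the registered `stub_ksTwin` shape from the Λ-adic source Kolyvagin system -/

set_option synthInstance.maxHeartbeats 80000 in
set_option maxHeartbeats 800000 in
/-- **The registered stub `stub_ksTwin` of line beta-road (v14) from ONE Λ-adic Kolyvagin system for the twin** (the body of v15's
`stub_ksTwinLambda`): in the binders of crux 24737 (bucket-B twin `W′`, `ρ̄₃` onto, conductor `N′`, `K` imaginary quadratic Heegner for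
`N′` with odd `d_K`, `κ` anticyclotomic, `γ` a topological generator, a norm-coherent Heegner family `F`, its `Λ`-adic class `z ≠ 0` in a
datum `Dat`), IF for every choice of the presentation slots `π, cd, πbar, Dsrc` there is a Kolyvagin system on lit's `Λ`-adic source
setting of the twin (`S = {v ∣ 3N′}`, `𝓛 = 𝓛_E`, levels guard) with bottom class `Φ′(z)` — Howard's Thm. 2.3.1 / CGLS Thm. 4.1.1 +
Rem. 4.1.4 read at the MULTIPLICATIVE prime `3` — THEN the Eisenstein-level Kolyvagin systems with the link and `κ₁ ≠ 0` exist for all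
large `m` in exactly the registered shape (`S`, `m₁`; tame pins, `𝓛_E`, `s₁ = 1`, `t = (3 ·)`, `I = eisensteinH1Limit`, `jbar′ = jbar`).
[cite: Howard2004HeegnerKolyvagin, Thm. 2.3.1, Rem. 1.2.4, §1.6, proof of Thm. 2.2.10] [cite: CastellaGrossiLeeSkinner2022, Thm. 4.1.1, Rem. 4.1.4, §3.2, §3.4] -/
theorem twin_ksTwin_of_lambdaAdicKS
    (W' : WeierstrassCurve ℚ) [W'.IsElliptic] [W'.IsGloballyMinimal] (N' : ℕ) [NeZero N']
    (K : Type) [Field K] [NumberField K]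
    (_hm3 : Rank1Residual.Mult W' 3) (_htr : ¬ 3 ∣ padicValInt 3 W'.minimalDiscriminantInt)
    (hsurj : W'.HasSurjectiveModNGaloisRep 3) (hN : W'.conductorNorm ℤ = N') (hK : IsImaginaryQuadratic K)
    (hH : SatisfiesHeegnerHypothesis N' K) (_hodd : Odd (NumberField.discr K))
    (κ : ZpExtension K 3) (hκ : κ.IsAnticyclotomic)
    (γ : absoluteGaloisGroup K) [hγ : Fact (κ.IsTopGenerator γ)]
    (jbar : AlgebraicClosure K →+* ℂ) (F : HeegnerFamily N' W' K κ jbar) (α : ℤ)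
    (_hc : ¬ (3 : ℤ) ∣ F.Dt.c) (_hα : α ^ 2 = 1) (_hcoh : F.IsNormCompatible γ α)
    (Dat : (W'.baseChange K).LambdaAdicSelmerData κ γ) (z : Dat.S)
    (_hz : Castella2024.IsLambdaAdicHeegnerClass Dat F α z) (hz0 : z ≠ 0)
    (hsrc : ∀ (π : ∀ v : HeightOneSpectrum (𝓞 K), TamePin v) (cd : ConjugationDatum K)
        (πbar : letI := W'.shapiroResidueModule K 3
          ∀ j, W'.ShapiroLevel K 3 j →ₗ[IwasawaAlgebra 3 ⧸ shapiroIdeal 3 (j + 1)] geomTorsion (W'.baseChange K) ((3 : ℕ) : ℤ))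
        (Dsrc : ∀ j, DualityDatum 3 cd ((W'.shapiroTower K 3 (κ.unitTwist (-1))).ρ j) (IwasawaAlgebra 3 ⧸ shapiroIdeal 3 (j + 1))),
        letI := W'.shapiroResidueModule K 3
        ∃ κsrc : (W'.shapiroSettingTame (κ.unitTwist (-1)) π
        (fun n v ↦ n ∈ levels (CastellaGrossiLeeSkinner2022.heegnerKolyvaginPrimes W' (κ.unitTwist (-1))
          (CastellaGrossiLeeSkinner2022.placesDividing K (3 * N') CastellaGrossiLeeSkinner2022.mul_level_ne_zero)) ∧ v ∈ n)
        (W'.shapiroTameHyp_of_mem_levels (κ.unitTwist (-1))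
          (CastellaGrossiLeeSkinner2022.placesDividing K (3 * N') CastellaGrossiLeeSkinner2022.mul_level_ne_zero)
          (fun _ hv ↦ CastellaGrossiLeeSkinner2022.mem_placesDividing_of_dvd CastellaGrossiLeeSkinner2022.mul_level_ne_zero
            (dvd_mul_right 3 N') hv)
          (fun _ hv _ ↦ CastellaGrossiLeeSkinner2022.hasGoodReductionAt_of_not_mem_placesDividing W' hN.symm
            CastellaGrossiLeeSkinner2022.mul_level_ne_zero hv)
          (CastellaGrossiLeeSkinner2022.heegnerKolyvaginPrimes W' (κ.unitTwist (-1))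
            (CastellaGrossiLeeSkinner2022.placesDividing K (3 * N') CastellaGrossiLeeSkinner2022.mul_level_ne_zero))
          (CastellaGrossiLeeSkinner2022.heegnerKolyvaginPrimes_subset_degreeTwoPrimes W' (κ.unitTwist (-1)) _)
          (fun _ hv ↦ CastellaGrossiLeeSkinner2022.not_mem_of_mem_heegnerKolyvaginPrimes W' (κ.unitTwist (-1)) _ hv))
        (CastellaGrossiLeeSkinner2022.placesDividing K (3 * N') CastellaGrossiLeeSkinner2022.mul_level_ne_zero)
        (fun _ hv ↦ CastellaGrossiLeeSkinner2022.mem_placesDividing_of_dvd CastellaGrossiLeeSkinner2022.mul_level_ne_zero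
          (dvd_mul_right 3 N') hv)
        (fun _ hv _ ↦ CastellaGrossiLeeSkinner2022.hasGoodReductionAt_of_not_mem_placesDividing W' hN.symm
          CastellaGrossiLeeSkinner2022.mul_level_ne_zero hv)
        (CastellaGrossiLeeSkinner2022.heegnerKolyvaginPrimes W' (κ.unitTwist (-1))
          (CastellaGrossiLeeSkinner2022.placesDividing K (3 * N') CastellaGrossiLeeSkinner2022.mul_level_ne_zero))
        (CastellaGrossiLeeSkinner2022.heegnerKolyvaginPrimes_subset_degreeTwoPrimes W' (κ.unitTwist (-1)) _)
        (fun _ hv ↦ CastellaGrossiLeeSkinner2022.not_mem_of_mem_heegnerKolyvaginPrimes W' (κ.unitTwist (-1)) _ hv)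
        jbar cd πbar Dsrc).KolyvaginSystem,
          κsrc.one = (W'.toShapiroSuccLimitH1 Dat hγ.out (Summit.BirchSwinnertonDyer.BirchSwinnertonDyer.Theorems.UniversalToricDescentTowerTorsion.baseChange_noPTorsion_of_surjective W' 3 hsurj K hK) z).1) :
      ∃ (S : Finset (HeightOneSpectrum (𝓞 K)))
        (hpS : ∀ v, ((3 : ℕ) : 𝓞 K) ∈ v.asIdeal → v ∈ S)
        (hbad : ∀ v, v ∉ S → ((3 : ℕ) : 𝓞 K) ∉ v.asIdeal → (W'.baseChange K).HasGoodReductionAt v)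
        (_hSN : ∀ v ∈ S, ((3 : ℕ) : 𝓞 K) ∈ v.asIdeal ∨ ((N' : ℕ) : 𝓞 K) ∈ v.asIdeal)
        (_hSσ : ∀ (σ : K ≃ₐ[ℚ] K) (v : HeightOneSpectrum (𝓞 K)), σ • v ∈ S → v ∈ S)
        (m₁ : ℕ), ∀ (m : ℕ) (hm : 1 ≤ m), m₁ ≤ m →
        letI := IwasawaAlgebra.isDomain_quotient_X_pow_add_C 3 hm
        letI := IwasawaAlgebra.isDiscreteValuationRing_quotient_X_pow_add_C 3 hm
        haveI := IwasawaAlgebra.EisensteinCoeff.isLocalRing_succ 3 hm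
        letI := IwasawaAlgebra.EisensteinCoeff.algebraOfSpecSucc 3 m
        haveI := W'.isScalarTower_algebraOfSpecSucc (K := K) (p := 3) (m := m)
        letI := W'.residueModuleSucc (K := K) (p := 3) hm
        ∃ (π : ∀ v : HeightOneSpectrum (𝓞 K), TamePin v) (L : Set (HeightOneSpectrum (𝓞 K)))
          (hL : L ⊆ (W'.eisensteinTower (κ.unitTwist (-1)) hm).degreeTwoPrimes 3) (hLS : ∀ v ∈ L, v ∉ S)
          (s₁ : ℕ) (_hsub : ∀ v ∈ (W'.eisensteinTower (κ.unitTwist (-1)) hm).kolyvaginPrimes 3 s₁, v ∉ S → v ∈ L)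
          (t : ∀ k, ((W'.baseChange K).torsionGaloisModule (((3 : ℕ) : ℤ) ^ (k + 1))).toContRepresentation →ⁱL
            ((W'.baseChange K).torsionGaloisModule (((3 : ℕ) : ℤ) ^ k)).toContRepresentation)
          (ht : ∀ k (P : geomTorsion (W'.baseChange K) (((3 : ℕ) : ℤ) ^ (k + 1))),
            t k P = (W'.baseChange K).geomTorsionReduce 3 k P)
          (I : ZpExtension.EisensteinH1Data (κ.unitTwist (-1))
            (fun k ↦ (W'.baseChange K).torsionGaloisModule (((3 : ℕ) : ℤ) ^ k)) t hm)
          (jbar' : AlgebraicClosure K →+* ℂ),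
          ∀ (cd : ConjugationDatum K)
            (Dd : ∀ k, DualityDatum 3 cd ((W'.eisensteinTower (κ.unitTwist (-1)) hm).ρ k)
              (IwasawaAlgebra.EisensteinCoeff 3 m (k + 1)))
            (hy : (W'.eisensteinDVRSettingLevelsTame (κ.unitTwist (-1)) hm π S hpS hbad L hL hLS jbar' cd Dd).SatisfiesH),
            ∃ κKS : (W'.eisensteinDVRSettingLevelsTame (κ.unitTwist (-1)) hm π S hpS hbad L hL hLS jbar' cd Dd).KolyvaginSystem,
              κKS.one ≠ 0 ∧
              ∀ k, κKS.one k = I.proj (k + 1) (Dat.toEisensteinH1Linear hm t ht I hγ.out (Summit.BirchSwinnertonDyer.BirchSwinnertonDyer.Theorems.UniversalToricDescentTowerTorsion.baseChange_noPTorsion_of_surjective W' 3 hsurj K hK) z)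
 := by
  have hπ0 : ∀ v : HeightOneSpectrum (𝓞 K), Nonempty (TamePin v) := nonempty_tamePin
  obtain ⟨m₁, hKS⟩ := W'.exists_ksLink_of_source κ hN.symm hK hκ hH hγ.out (Summit.BirchSwinnertonDyer.BirchSwinnertonDyer.Theorems.UniversalToricDescentTowerTorsion.baseChange_noPTorsion_of_surjective W' 3 hsurj K hK) jbar Dat z hz0 hsrc
  refine ⟨CastellaGrossiLeeSkinner2022.placesDividing K (3 * N') CastellaGrossiLeeSkinner2022.mul_level_ne_zero,
    fun _ hv ↦ CastellaGrossiLeeSkinner2022.mem_placesDividing_of_dvd CastellaGrossiLeeSkinner2022.mul_level_ne_zero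
      (dvd_mul_right 3 N') hv,
    fun _ hv _ ↦ CastellaGrossiLeeSkinner2022.hasGoodReductionAt_of_not_mem_placesDividing W' hN.symm
      CastellaGrossiLeeSkinner2022.mul_level_ne_zero hv,
    fun _ hv ↦ CastellaGrossiLeeSkinner2022.natCast_mem_or_natCast_mem_of_mem_placesDividing
      CastellaGrossiLeeSkinner2022.mul_level_ne_zero hv,
    fun σ v hv ↦ CastellaGrossiLeeSkinner2022.mem_placesDividing_of_smul_mem CastellaGrossiLeeSkinner2022.mul_level_ne_zero
      σ v hv,
    m₁, fun m hm hle ↦ ?_⟩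
  letI := IwasawaAlgebra.isDomain_quotient_X_pow_add_C 3 hm
  letI := IwasawaAlgebra.isDiscreteValuationRing_quotient_X_pow_add_C 3 hm
  haveI := IwasawaAlgebra.EisensteinCoeff.isLocalRing_succ 3 hm
  letI := IwasawaAlgebra.EisensteinCoeff.algebraOfSpecSucc 3 m
  haveI := W'.isScalarTower_algebraOfSpecSucc (K := K) (p := 3) (m := m)
  letI := W'.residueModuleSucc (K := K) (p := 3) hm
  refine ⟨fun v ↦ (hπ0 v).some,
    CastellaGrossiLeeSkinner2022.heegnerKolyvaginPrimes W' (κ.unitTwist (-1))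
      (CastellaGrossiLeeSkinner2022.placesDividing K (3 * N') CastellaGrossiLeeSkinner2022.mul_level_ne_zero),
    W'.heegnerKolyvaginPrimes_subset_degreeTwoPrimes_eisensteinTower (κ.unitTwist (-1)) hm (κ.unitTwist (-1))
      (CastellaGrossiLeeSkinner2022.placesDividing K (3 * N') CastellaGrossiLeeSkinner2022.mul_level_ne_zero)
      (fun _ hv _ ↦ CastellaGrossiLeeSkinner2022.hasGoodReductionAt_of_not_mem_placesDividing W' hN.symm
        CastellaGrossiLeeSkinner2022.mul_level_ne_zero hv),
    fun _ hv ↦ CastellaGrossiLeeSkinner2022.not_mem_of_mem_heegnerKolyvaginPrimes W' (κ.unitTwist (-1)) _ hv,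
    1, W'.kolyvaginPrimes_eisensteinTower_subset_heegnerKolyvaginPrimes (κ.unitTwist (-1)) hm hK
      (hκ.unitTwist (-1)) _ le_rfl,
    fun j ↦ (W'.baseChange K).torsionGaloisModuleReduce 3 j, fun _ _ ↦ rfl,
    (κ.unitTwist (-1)).eisensteinH1Limit (fun k ↦ (W'.baseChange K).torsionGaloisModule (((3 : ℕ) : ℤ) ^ k))
      (fun j ↦ (W'.baseChange K).torsionGaloisModuleReduce 3 j) hm,
    jbar, fun cd Dd hy ↦ ?_⟩
  exact hKS m hm hle _ cd Dd hy

end WeierstrassCurve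

end
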